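import Summits.ABC.IUTFork.LanaProcedureReal
import Summits.ABC.IUTFork.LanaRealCor312Checks
import Summits.ABC.IUTFork.LanaWitnesses
import HarnessLib

/-!
# L-LANA checks III: the §8.1 procedure over REAL objects is inhabited with (8-1) TRUE and with (8-1) FALSE — the typed inputs do not decide Cor. 3.12's inequality (Team-R datum at the LANA level)

Record-only check file (D-0012) of the abc-iut cell (seat abc-iut-c312-4, L-LANA level; vacuity audit of the
gen-2 assembly `LanaProcedureRealInput` and the LANA-level form of the cell's Team-R question "exhibit the
identification under which the inequality becomes vacuous/false", human ruling D-0067); TAKES NO SIDE on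
[IUTchIII] Cor. 3.12 — the inputs below are SYNTHETIC (trivial étale theta side, hand-chosen possible images),
not the output of Thm. 3.11's algorithm. Over `ℚ_p`: the big-H diagram of gen-0's `LanaWitnesses.padicBigH`
(real `G_{ℚ_p} ↷ O^{×μ}`, Θ-links with nonempty gluing), the Fig. 3 signature with REAL local Kummer maps
`κ_t` on `O^▷_{ℚ̄_p}` and a trivial étale theta side (`trivialThetaSide`, whose p. 36 CONTAINMENT HOLDS,
`trivialThetaSide_containment`), and the real container `(ℚ_p, μ_{ℤ_p})` with the REAL hull:

* `holdInput p` (possible images `p·ℤ_p`): a `LanaProcedureRealInput` whose procedure satisfies (9-1) and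
  (8-1) (`holdInput_cor312`);
* `failInput p` (possible images `p²·ℤ_p`): a `LanaProcedureRealInput` — SAME big-H, SAME signatures with
  containment, SAME container, `q`, measure and hull construction — whose procedure VIOLATES (8-1)
  (`failInput_not_cor312`) and (9-1);
* `typed_inputs_do_not_decide_cor312` — the conjunction. READING (no side taken): at the LANA level, the
  typed §8.1 inputs — including Thm. 3.11 (ii) in LANA's p. 36 "containment" form and every object this cell
  could make real — do NOT by themselves imply `−|log(q)| ≤ −|log(Θ)|`; what decides it is the family of
  possible images `{U_λ}` / LANA's (9-1), i.e. the quantitative content of Thm. 3.11 and (Ind1–3) — exactly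
  LANA §10.5's own position ("we … do not have a proof of (9-1) at this time").

[cite: LANA2026Report, §8.1 (8-1) p. 41, Rem. 8.2.1 p. 42, §9.2 (9-1) p. 46, §10.5 p. 49] NOT here: any judgement.
-/

noncomputable section

open MeasureTheory Set Metric Bornology
open Literature.IUT.LogVolume

namespace Summit.ABC
namespace IUTFork

namespace RealHullChecks

variable (p : ℕ) [hp : Fact p.Prime] [MeasurableSpace ℚ_[p]] [BorelSpace ℚ_[p]]

/-- **A trivial étale theta side over the label field `ℚ_p`**: one label, all theta-side groups trivial, the
local Kummer side REAL (`K _ := ℚ_p`), cyclotomic synchronization the identity of the real `∞H¹`, theta value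
`1 ∈ O^▷`. [cite: LANA2026Report, §6.2 pp. 33–36] -/
def trivialThetaSide : EtaThetaSide where
  H1Y := PUnit
  thetaClasses := ∅
  thetaInf := ⊥
  unitsEt := ⊥
  thetaClasses_subset := Set.empty_subset _
  MFrob := PUnit
  H1Yext := PUnit
  kum := 1
  rgd := MulEquiv.refl PUnit
  T := Unit
  K _ := ℚ_[p]
  H1D _ := Multiplicative (AlgCl.H1Tower ℚ_[p])
  res _ := 1
  sync _ := MulEquiv.refl _
  qPow _ := 1

omit [MeasurableSpace ℚ_[p]] [BorelSpace ℚ_[p]] in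
/-- For the trivial theta side the p. 36 CONTAINMENT HOLDS: `Im ψ_v = {1} ⊆ Im φ_v` — so the hypothesis field
`containment` of the assembly is satisfiable over real local Kummer maps. [cite: LANA2026Report, §6.2 (g) p. 36] -/
theorem trivialThetaSide_containment : (trivialThetaSide p).toEtaSteps.Containment := by
  rintro _ ⟨m, rfl⟩
  refine ⟨1, ?_⟩
  rw [map_one]
  funext t
  change (1 : ∀ t, (trivialThetaSide p).toEtaSteps.H1D t) t =
    (trivialThetaSide p).toEtaSteps.res t ((trivialThetaSide p).toEtaSteps.rgd ((trivialThetaSide p).toEtaSteps.kum m))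
  change (1 : Multiplicative (AlgCl.H1Tower ℚ_[p])) = (1 : PUnit →* Multiplicative (AlgCl.H1Tower ℚ_[p])) _
  rw [MonoidHom.one_apply]

/-- **Input with (8-1) TRUE**: `ℚ_p` big-H, trivial theta sides (containment holds), real container, possible
images `p·ℤ_p` (`LanaRealHullChecks.padicInput`). [cite: LANA2026Report, §8.1 pp. 40–41] -/
def holdInput : LanaProcedureRealInput (refOne p) Finset.univ (summand p) (intStructure p) where
  bigH := padicBigH p
  eta _ := trivialThetaSide p
  containment _ := trivialThetaSide_containment p
  hull := padicInput p

/-- **Input with (8-1) FALSE**: identical except possible images `p²·ℤ_p` (`padicInputSq`).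
[cite: LANA2026Report, §8.1 pp. 40–41] -/
def failInput : LanaProcedureRealInput (refOne p) Finset.univ (summand p) (intStructure p) where
  bigH := padicBigH p
  eta _ := trivialThetaSide p
  containment _ := trivialThetaSide_containment p
  hull := padicInputSq p

/-- For `holdInput`, (9-1) and hence (8-1) hold. [cite: LANA2026Report, §8.1 (8-1) p. 41] -/
theorem holdInput_cor312 : (holdInput p).toProcedure.MainGoal ∧ (holdInput p).toProcedure.Cor312 :=
  ⟨padicInput_mainGoal p, (holdInput p).toProcedure.cor312_of_mainGoal (padicInput_mainGoal p)⟩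

/-- For `failInput`, (8-1) FAILS (and so does (9-1)). [cite: LANA2026Report, §8.1 (8-1) p. 41, Rem. 8.2.1 p. 42] -/
theorem failInput_not_cor312 : ¬ (failInput p).toProcedure.Cor312 ∧ ¬ (failInput p).toProcedure.MainGoal :=
  ⟨padicInputSq_not_cor312 p, padicInputSq_not_mainGoal p⟩

/-- The two inputs share the big-H diagram, the signatures (with containment), the container, the measure, the
`q`-pilot element and the hull CONSTRUCTION. [cite: LANA2026Report, §10.4 p. 49] -/
theorem inputs_agree :
    (holdInput p).bigH = (failInput p).bigH ∧ (holdInput p).eta = (failInput p).eta ∧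
      (holdInput p).hull.q = (failInput p).hull.q := ⟨rfl, rfl, rfl⟩

/-- **The typed §8.1 inputs over real objects do NOT decide (8-1)** (LANA-level Team-R datum; see the module
docstring for the reading). [cite: LANA2026Report, §8.1 (i) p. 41, §10.5 p. 49] -/
theorem typed_inputs_do_not_decide_cor312 :
    (holdInput p).toProcedure.Cor312 ∧ ¬ (failInput p).toProcedure.Cor312 :=
  ⟨(holdInput_cor312 p).2, (failInput_not_cor312 p).1⟩

/-- … while at torally Kummer-faithful labels (here `ℚ_p`) both procedures DO have the §9.1 (f) factorisation of
`ψ_v` — the Kummer-side bookkeeping is not what distinguishes them. [cite: LANA2026Report, §9.1 (f) p. 45] -/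
theorem both_factor (v : Unit) :
    ((holdInput p).toProcedure.eta v).Factors ∧ ((failInput p).toProcedure.eta v).Factors :=
  ⟨(holdInput p).factors v fun _ =>
      Literature.AnabelianGeometry.AbsoluteAnabelian.AbsTopIII.isTorallyKummerFaithful_padic p,
    (failInput p).factors v fun _ =>
      Literature.AnabelianGeometry.AbsoluteAnabelian.AbsTopIII.isTorallyKummerFaithful_padic p⟩

end RealHullChecks

end IUTFork

end Summit.ABC

end
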